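import Literature.IUT.LogVolume.PacketVolume
import Literature.IUT.LogThetaLattice.PacketLogVolumes
import Literature.IUT.LogThetaLattice.PacketWeights
import HarnessLib

/-!
# The concrete model of [IUTchIII] Prop. 3.9 (i) / Rmk. 3.1.1: L6's parameterised packet log-volumes,
# weights, regions and procession averages AT the constructed volumes

The layer-L6 statement files `Literature/IUT/LogThetaLattice/PacketLogVolumes.lean` and
`PacketWeights.lean` (typer abc-iut-L6-t4) type [IUTchIII] Prop. 3.9 (i) and Rmk. 3.1.1 (ii)–(iv) with
the Haar measures `μ_i` of the summands and the degrees as PARAMETERS: `packetLogVolume w μ T =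
Σ_i w_i·log μ_i(T_i)`, `IsDirectProductRegion μ S`, `packetWeight degF degKF`, `processionNormalized`.
This directory CONSTRUCTS those parameters (`IntegralStructure.haar`, `unitBallStructure`,
`localVolume`, …). This file records that L6's notions, instantiated at the constructed volumes, ARE
this directory's notions — so every theorem on either side transports:

* (the definitional identifications `packetLogVolume w (Λ_j.haar) = weightedLogVolume Λ w` and
  `processionNormalized = processionAverage` are L6-t4's `PacketLogVolumeBridge.lean` /
  `ProcessionAverageBridge.lean`, not repeated here);
* `lt_isDirectProductRegion_iff`: L6's direct product regions (as subsets) at the volumes `μ_{Λ_j}` are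
  the boxes of this directory's direct product regions (as families of factors);
* `lt_packetWeight_eq`: L6's normalized weight is `IntegralStructure.normalizedWeight`;
* consequently the printed properties PROVED here hold for L6's typed objects at the model, e.g.
  `lt_packetLogVolume_natCast_smul` — "multiplication by `p_v` corresponds to adding `−log(p_v)`" — with
  the hypothesis `hscale` of L6's `packetLogVolume_packetNormalized` DISCHARGED by the local-field
  computation `μ_{K_j}(p·A) = p^{−e_j f_j}·μ_{K_j}(A)`.
[cite: Mochizuki2012, IUTchIII Prop. 3.9 (i) pp. 115–116; Rmk. 3.1.1 (ii)–(iv) pp. 94–97]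
Deliberately NOT here: the `E`-weighted measure (L6's `weightedMeasure`, already proved there to reduce
to the weighted sum on direct product regions), archimedean summands, any judgement on Cor. 3.12.
-/

noncomputable section

open MeasureTheory MeasureTheory.Measure Set Metric TopologicalSpace
open scoped ENNReal NNReal Pointwise NormedField
open Literature.NumberTheory.GaloisRepresentations.Ultrametric

namespace Literature.IUT.LogVolume

/-! ### Packet log-volumes and regions over arbitrary integral structures -/

section General

variable {J : Type*} [Fintype J] {V : J → Type*} [∀ j, AddCommGroup (V j)]
  [∀ j, TopologicalSpace (V j)] [∀ j, IsTopologicalAddGroup (V j)] [∀ j, MeasurableSpace (V j)]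
  [∀ j, BorelSpace (V j)] (Λ : ∀ j, IntegralStructure (V j))

omit [Fintype J] in
/-- L6's direct product regions (subsets of `⊕ V_j`) at the volumes `μ_{Λ_j}` are exactly the boxes of
this directory's direct product regions (families of factors). [cite: Mochizuki2012, IUTchIII Rmk. 3.1.1 (iii) p. 95] -/
theorem lt_isDirectProductRegion_iff (S : Set (Π j, V j)) :
    LogThetaLattice.IsDirectProductRegion (fun j => (Λ j).haar) S ↔
      ∃ T : ∀ j, Set (V j), S = Set.pi univ T ∧ IntegralStructure.IsDirectProductRegion Λ T := by
  constructor
  · rintro ⟨T, rfl, hT⟩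
    exact ⟨T, rfl, ⟨fun j => (hT j).1, fun j => (hT j).2⟩⟩
  · rintro ⟨T, rfl, hT⟩
    exact ⟨T, rfl, fun j => ⟨hT.isCompact j, hT.pos j⟩⟩

/-- L6's "log-volume of the integral structures is zero" at the model (their hypothesis
`μ_i(O_i) = 1` is this directory's normalisation `Λ_j.haar Λ_j = 1`).
[cite: Mochizuki2012, IUTchIII Prop. 3.9 (i) p. 115] -/
theorem lt_packetLogVolume_integralStructure (w : J → ℝ) :
    LogThetaLattice.packetLogVolume w (fun j => (Λ j).haar) (fun j => (Λ j : Set (V j))) = 0 :=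
  LogThetaLattice.packetLogVolume_integralStructure w _ _ fun j => (Λ j).haar_self

end General

/-! ### Weights -/

/-- **L6's normalized weight is `normalizedWeight`**: `packetWeight degF degKF w =
normalizedWeight (degKF) (degF) w` (`N_w = [K_v:(F_mod)_v]`, `D_w = [(F_mod)_w:ℚ_{v_ℚ}]`).
[cite: Mochizuki2012, IUTchIII Rmk. 3.1.1 (ii) p. 94] -/
theorem lt_packetWeight_eq {W : Type*} [Fintype W] (degF degKF : W → ℕ+) (w : W) :
    LogThetaLattice.packetWeight degF degKF w =
      IntegralStructure.normalizedWeight (fun w => (degKF w : ℕ)) (fun w => (degF w : ℕ)) w := by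
  simp [LogThetaLattice.packetWeight, IntegralStructure.normalizedWeight]

/-! ### Local fields: L6's packet-normalisation hypothesis discharged -/

section LocalFields

variable {J : Type*} [Fintype J] (K : J → Type*) [∀ j, NontriviallyNormedField (K j)]
  [∀ j, IsUltrametricDist (K j)] [∀ j, ProperSpace (K j)] [∀ j, MeasurableSpace (K j)]
  [∀ j, BorelSpace (K j)]

omit [Fintype J] in
/-- The scaling hypothesis `hscale` of L6's `packetLogVolume_packetNormalized`, DISCHARGED for local
fields: `μ_{K}(p·A) = p^{−e·f}·μ_K(A)` when `‖p‖ = ‖ϖ‖^e` and `q = p^f`.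
[cite: Mochizuki2012, IUTchIV Prop. 1.4 (i) p. 13] -/
theorem localVolume_real_natCast_smul (j : J) {ϖ : (K j)ˣ} (hϖ : IsUniformizer ϖ) {p e f : ℕ}
    (hp0 : (p : K j) ≠ 0) (hp : ‖(p : K j)‖ = ‖(ϖ : K j)‖ ^ e) (hq : residueCard (K j) = p ^ f)
    (A : Set (K j)) :
    (localVolume (K j) ((p : K j) • A)).toReal = (p : ℝ)⁻¹ ^ (e * f) * (localVolume (K j) A).toReal := by
  have hunit : (p : K j) • A = (Units.mk0 (p : K j) hp0) • A := rfl
  rw [hunit, localVolume_units_smul, ENNReal.toReal_mul, ENNReal.coe_toReal]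
  congr 1
  -- `distribHaarChar K p = p^{-ef}`: `p` and `ϖ^e` have the same norm
  have hx : ‖((Units.mk0 (p : K j) hp0 : (K j)ˣ) : K j)‖ = ‖((ϖ ^ (e : ℤ) : (K j)ˣ) : K j)‖ := by
    rw [Units.val_mk0, hp, Units.val_zpow_eq_zpow_val, zpow_natCast, norm_pow]
  have hvol := mulVolume_eq_of_norm_eq K j hx
  rw [mulVolume_eq_distribHaarChar, mulVolume_eq_distribHaarChar, map_zpow,
    distribHaarChar_uniformizer_eq (K j) hϖ, hq] at hvol
  have := congrArg (fun z : ℝ≥0∞ => z.toReal) hvol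
  simp only [ENNReal.coe_toReal] at this
  rw [this]
  push_cast
  rw [zpow_natCast, ← inv_pow, ← pow_mul, mul_comm f e]

/-- **L6's packet-normalisation at the model**: L6's typed statement `packetLogVolume_packetNormalized`
applied with its scaling hypothesis discharged — multiplying every factor of a direct product region by
`p` subtracts exactly `log p` when `Σ_j w_j e_j f_j = 1`.
[cite: Mochizuki2012, IUTchIII Prop. 3.9 (i) p. 115] -/
theorem lt_packetLogVolume_natCast_smul (w : J → ℝ) {p : ℕ} (hp1 : 0 < p) (hp0 : ∀ j, (p : K j) ≠ 0)
    (ϖ : Π j, (K j)ˣ) (hϖ : ∀ j, IsUniformizer (ϖ j)) (e f : J → ℕ)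
    (hp : ∀ j, ‖(p : K j)‖ = ‖(ϖ j : K j)‖ ^ (e j)) (hq : ∀ j, residueCard (K j) = p ^ (f j))
    (hw : ∑ j, w j * (e j * f j : ℕ) = 1) {A : Π j, Set (K j)}
    (hA : IntegralStructure.IsDirectProductRegion (fun j => unitBallStructure (K j)) A) :
    LogThetaLattice.packetLogVolume w (fun j => localVolume (K j)) (fun j => (p : K j) • A j) =
      LogThetaLattice.packetLogVolume w (fun j => localVolume (K j)) A - Real.log p := by
  refine LogThetaLattice.packetLogVolume_packetNormalized w _ (fun j => e j * f j) (p : ℝ)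
    (by exact_mod_cast hp1) hw A _ (fun j => ?_) (fun j => ?_)
  · exact (ENNReal.toReal_pos (hA.pos j).ne' (hA.lt_top _ j).ne).ne'
  · exact localVolume_real_natCast_smul K j (hϖ j) (hp0 j) (hp j) (hq j) (A j)

end LocalFields

end Literature.IUT.LogVolume
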